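import Literature.MathematicalPhysics.QuantumFieldTheory.Balaban1983to89.T4HistoryPeeling
import Literature.MathematicalPhysics.QuantumFieldTheory.Balaban1983to89.T4IndicatorShell
import Literature.MathematicalPhysics.QuantumFieldTheory.Balaban1983to89.T4Assembly

/-!
# T4MatchingAssembly — node U5 (MATCHING MODULO CONSTANTS — THE ASSEMBLY): NE7 in hybrid form as ONE named `Prop`,
the matching construction (A-classes of B-terms, good/bad split, weight slot `W + Wsh`), the head/tail gluing, and the
plug into the scheme-level targets of `T4Assembly` (cell `pub-balaban`, T4-DAG v5 §2 nodes U5/U5d/U6/U0, §5 row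
T4-U5.E; typing + kernel bookkeeping only)

HONEST FRAMING (T4-DAG PAGE 1).  The cell's T4 target is rung (B)+1: existence AND uniqueness of the `ε → 0` limit of
Bałaban's unit-scale averaged loop expectations on a FIXED finite torus — strictly beyond ultraviolet stability
([Balaban1988Convergent] Cor. 3 p. 264; [Balaban1989LargeFieldII] Thm 1 p. 355), NOT infinite volume, NOT a mass gap,
NOT the Clay problem.  Node U5 compares the final-scale density expansions of TWO runs of the renormalization group
(run A: `K` steps from spacing `L^{−K}`; run B: `K + 1` steps from `L^{−K−1}`) driven by the SAME unit-lattice field.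
NOTHING OF THIS COMPARISON IS PRINTED — the manuscripts under audit construct ONE run and bound it uniformly in `ε`;
the only printed TEMPLATE is King's d = 2, 3 Cauchy estimate (small-field part matched term-wise through the effective
actions, large-field complement booked BY WEIGHT), [King1986] (3.10)–(3.13) pp. 656–657, quoted verbatim in the tree's
`T4HybridMatching` header (cross-read C-pv28g3-1); why d = 4 needs the RELATIVE (modulo constants) form of the same
split is [Balaban1989LargeFieldI] p. 175 (quoted ibid.).  This module ASSERTS NOTHING about Bałaban's objects: every
estimate below is a HYPOTHESIS SHAPE consumed BY NAME from the tree modules of the carved thirds of row T4-U5.E, and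
everything proved is elementary real analysis over finite sums ([folklore]).  Value = the typed statement of the
cell's new estimate NE7 in hybrid form with exact quantifier order + kernel bookkeeping of the implication
"named inputs ⇒ `T4CauchySum.MatchingModConstants` ⇒ `T4Assembly.GenFunCauchy` ⇒ the U0 targets"; NOT summit progress.

WHAT IS ASSEMBLED (inputs BY NAME; none is constructed here).
* (a) Row T4-U5.E-a — the OLD-structure weight bound NE7b of BOTH runs in domination form: `T4HistoryPeeling.SlotDom`
  (unit pv14 gen 5) / `T4PeierlsDomination.PeierlsDom`, `PosDom` (unit pv10 gen 5) / `T4WeightBudgetKP.PolymerDom`, with a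
  common slot budget `S ≥ 0`, `Σ_K S K < ∞` ⇒ `T4WeightBudget.RelWeightBound … (fun K ↦ 1 − exp (−S K))`
  (`relWeightBound_of_slotDom` / `_of_peierlsDom` / `_of_posDom`); the two-rate budget
  `S K = C·V·r^{K − j⋆(K) + 1}/(1 − r)` is summable under INTERFACE CONDITION I-1 `c·K ≤ K − j⋆(K)`
  (`T4HistoryPeeling.summable_twoRateBudget`, `relWeightBound_of_slotDom_twoRate`).
* (NE7c) Row T4-U5b.E2 — the indicator-shell weight bound `T4IndicatorShell.ShellWeightBound … shA shB Wsh` (unit pv07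
  gen 6; design (i) COMMON REFINEMENT: the good-class sandwich is asked on CORES `A − shA`, `B − shB` only).
* (b) Row T4-U5.E-b — the recent-scale GOOD-CLASS budget: the core sandwich clause `hcore` below (binder-for-binder the
  `hcore` of `T4IndicatorShell.cauchy_of_relWeightBound_shell`, i.e. the `hgood` of
  `T4WeightBudget.hybridSandwich_of_relWeightBound` on cores), produced per good class by
  `T4RecentScale.goodTerm_sandwich` / `density_sandwich` / `sum_rate_le_crossoverShape` (unit pv16) with the boundary
  pieces at recent scales RATE-matched through the carrier of row T4-U3.B (`T4BoundaryCarrier`, unit b02 gen 8;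
  decision (α-B)), and with Σ_K δ_K < ∞ from node U4′ (`T4Crossover.summable_crossoverDelta`).
* (c) Row T4-U5.E-c — nested pending levels and run B's extra finest level INSIDE a class: `T4NestedLevels`
  (unit b01 gen 8: `goodTerm_sandwich_nested`, `Sandwiched.of_extra`, `Sandwiched.of_shell`) feeds (b); it is not opened
  here.  The COMPLEMENTARY bookkeeping of node U5d at the level of INDEX SETS — run B's own term family `b` on its own
  finite index sets `SB K ⊆ σ`, partially summed into run A's classes along a class map `π K : σ → ι`
  (`T4HybridMatching.fiberSum`), with run B's bad sub-histories allowed to be a LARGER set than the preimage of run A's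
  bad classes (a B-history whose only old pending structure was born at B's finest scale has a GOOD A-class) — is §3:
  the excess is booked as run-B SHELL mass, so that it costs weight, never a rate (`classBad_le`, `shell_right_of_fibres`,
  `relWeightBound_of_fibres`, `shellWeightBound_of_fibres`).
* (E1/E2/L1-pos) the dictionary `Z K t = Σ_{τ ∈ T K} A K t τ`, `Z (K+1) t = Σ_{τ ∈ T K} B K t τ` on `|t| ≤ l₀` and the
  positivity of the total; for the scheme's dressed partition functions `T4GenFunBounds.schemeZ` positivity is the tree's
  `T4GenFunBounds.dressedZ_pos` (§5).

WHAT IS KERNEL-CHECKED HERE ([folklore]).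
§1 `HybridNE7` — NE7 IN HYBRID FORM as one `Prop`: `RelWeightBound` (NE7b, both runs) ∧ `ShellWeightBound` (NE7c) ∧
   `W K + Wsh K < 1` ∧ `Summable δ` ∧ the core sandwich on good classes with a `t`-INDEPENDENT constant `c_K`; and
   `HybridNE7.cauchy`: with the dictionary and positivity it gives `MatchingModConstants vol l₀ δ′ Z` with
   `δ′ = hybridDelta vol δ (W + Wsh)`, i.e. `vol·δ′_K = vol·δ_K − log(1 − W_K − Wsh_K)`, `Summable δ′`, every generating
   function Cauchy on `|t| ≤ l₀`, uniformly (= `T4IndicatorShell.cauchy_of_relWeightBound_shell`); the generic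
   constructor `hybridNE7_of_relWeightBound` (any producer of NE7b's output shape).
§2 the smallness `W + Wsh < 1` in budget form `Wsh K < exp (−S K)` (`lt_one_of_lt_exp`) and the constructors from the
   named inputs (a): `hybridNE7_of_peierlsDom`, `_of_slotDom`, `_of_posDom`, `_of_polymerDom`; the shell-free fallback
   `shellWeightBound_zero` / `hybridNE7_noShell` (design (ii′) common classifier, or shells already refined away).
§3 node U5d at index level (see (c)): `classVal`, `sum_classVal`, `classVal_nonneg`, `sum_classVal_eq_filter`,
   `classBad_le`, `classShell`, `classShell_nonneg_le`, `classVal_sub_classShell`, `shell_right_of_fibres`,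
   `relWeightBound_of_fibres`, `shellWeightBound_of_fibres`, `badB_of_peierlsDom`.
§4 SUMMABILITY IS A TAIL PROPERTY.  The hybrid hypotheses are only claimed (and only meaningful) from some `K₀` on
   (`W_K + Wsh_K < 1` eventually; `j⋆(K)` a fraction of `K`); the HEAD `K < K₀` is FREE: any bound
   `|genFun Z K t| ≤ G` on `|t| ≤ l₀` gives `|log Z_{K+1}(t) − log Z_K(t) − c_K| ≤ 2G` with
   `c_K = log Z_{K+1}(0) − log Z_K(0)` (`head_of_abs_genFun_le`), and `glueDelta` splices head and re-indexed tail into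
   ONE summable remainder sequence (`matchingModConstants_glue`, `summable_glueDelta`, `HybridNE7.matchingModConstants_tail`).
§5 THE PLUG INTO THE SCHEME.  For a `TorusScheme` with `β_K ≥ 0` and measurable observables bounded by `1` the head bound
   is the tree's `T4GenFunBounds.abs_genFun_schemeZ_le` (`|G_K(t)| ≤ |t|`) and positivity is `dressedZ_pos`, so a
   `HybridNE7` datum representing the string's dressed partition functions FROM `K₀` ON yields
   `∃ vol δ, Summable δ ∧ MatchingModConstants vol l₀ δ (schemeZ S os)` (`matchingModConstants_schemeZ`) — the per-string
   hypothesis of `T4Assembly.genFunCauchy_of_matchingModConstants`; over all strings: `GenFunCauchy S l₀`, hence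
   `HasContinuumLimit S`, `HasUniqueLimitPoints S`, `LimitPointsAgree S` (`genFunCauchy_of_hybridNE7`,
   `hasContinuumLimit_of_hybridNE7`) by the tree's node-U0 theorems.  §6: non-vacuity of `HybridNE7`.
§7 (v1.1, append-only) THE FULLY NAMED INSTANTIATION `hybridNE7_of_slotDom_twoRate_crossover`: weight half from
   `T4HistoryPeeling.relWeightBound_of_slotDom_twoRate` (two-rate slot budget, interface I-1 `hfrac`), remainders
   `T4Crossover.crossoverDelta …` summable by `summable_crossoverDelta` (node U4′: `0 < a < 1`, `0 < θ < 1`, (0.31) lower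
   recursion, `4 < κ₀`, summable extra `w`) — so that the loci of WHY-IT-MIGHT-FAIL (2) and (4) below are visible binders.

ROW T4-U5.E "WHY IT MIGHT FAIL" (T4-DAG §2 U5 (1)–(4)), ANSWERED LOCUS BY LOCUS (where each enters the typed statement).
(1) Observable-attached D-terms (node O3b) may lack `k`-uniform bounds through later T-steps ⇒ the dressed density's
    term-wise half fails: LOCUS = the binder `hcore` (its producers `T4RecentScale.FactorLogRatio` / `T4NestedLevels`
    carry the D-terms as factors of kind `smallFieldE`/pending blocks); if H2 is false as stated the cell's fallback O3-alt
    changes the producers of `hcore`, not this module.  The head `K < K₀` needs NO D-term bound (§4: `|G_K(t)| ≤ |t|`).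
(2) NE7b's condition on the survival window `N` versus `p₀(g)` against B15/B16's own conditions on `N`: COMPATIBLE over
    the whole printed window (cap `N ≤ R_k`, [Balaban1989LargeFieldII] p. 361; T4-XREAD-U5c, §8 Q7 closed): LOCUS = the
    budget `S` of (a) (`survivalRate`, `summable_weightMajorant`, `summable_twoRateBudget` with I-1); this module only
    requires `0 ≤ S`, `Summable S` (and, with shells, `Wsh K < exp(−S K)` from `K₀` on, §2/§4).
(3) L1-pos (positivity of the dressed density at real `t`): LOCUS = `hpos` and the non-negativity fields (I-2); for the
    scheme `hpos` is DISCHARGED by `T4GenFunBounds.dressedZ_pos` (§5); term-wise non-negativity stays a hypothesis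
    (`ShellWeightBound.sh_nonneg_*`/`sh_le_*`, `hA`/`hB` of the domination constructors).
(4) PRINTED [GawedzkiKupiainen1985] (142)–(143) p. 20 (quoted in the tree's `T4BetaMemory`): the marginal discrepancy does
    not contract, summability needs smallness at birth — here from node U2's `θ^j` (NE4 + `LimitForm.conv`) and U5d:
    LOCUS = `Summable δ` (field `HybridNE7.summable`, instantiated by `T4Crossover.summable_crossoverDelta` whose RATE
    branch is exactly U2's `θ^j`); if row T4-U2.R's scale-shift rate fails, `δ_K` is `O(g_K³)`-small but not summable and
    NOTHING below applies — the module then proves nothing, as it should.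

INTERFACE CONDITIONS OF T4-EST-U5c (i), AS BINDERS.  I-1 (`c·K ≤ K − j⋆(K)`): hypothesis `hfrac` of
`T4HistoryPeeling.summable_twoRateBudget` producing `Summable S` for (a).  I-2 (history-indexed terms NON-NEGATIVE at real
`t`): `hA`, `hB` (domination constructors), `hb` (§3), the `sh_*` fields of `ShellWeightBound`.  I-3 (the SAME badness
criterion — absolute creation scale `< j⋆(K)`, pending at the end — in both runs): ONE `Bad : ℕ → ℝ → Finset ι` for both
runs in `HybridNE7`; in the fibred presentation §3 the consistency `hcons : π K s ∈ Bad K t → s ∈ SBad K t` with the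
excess `SBad ∖ π⁻¹(Bad)` (finest-scale births of run B) booked as shell.
RC-X14-3 / H-X14-3 (T4-XREAD-U5X14): the printed `g`-argument sits only in `𝐄^{(j)}`, `β_j A(φ_j)`, `1/g_k²`, `E_k`;
`𝐑`-terms need no matching ((2.44)/(2.46)), `𝐁`-terms are the unrated residue — DECISION (α-B) of T4-DAG v4: boundary
pieces attached to RECENT structures are rate-matched through row T4-U3.B's carrier inside the producers of `hcore`;
boundary pieces attached to OLD pending structures lie in the bad class and cost weight only (binder (a)).  Nothing of
this decision is visible in the types below beyond the split `hcore` / `RelWeightBound`, which is the point.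

Versions.  v1 p181152 (commit c9efc16ce956): §1–§6 (XREAD ok, pv10-g5, C-pv10-37).  v1.1: + §7; docstring-only edits
answering the cross-reader's N1 (`summable_glueDelta`: «if», the theorem is one direction), R1 (`HybridNE7.core`: the
constant is uniform in the class as well as in `t`), R2 (`StringHybridNE7`: index type in `Type`); statements and proofs
of v1 unchanged.

Sources.  [King1986] (3.10)–(3.13) pp. 656–657 — printed TEMPLATE, context only; [Balaban1989LargeFieldI] p. 175,
[Balaban1989LargeFieldII] pp. 355, 361, [GawedzkiKupiainen1985] p. 20 — CONTEXT / LOCATION ONLY, as quoted in the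
tree modules named above; no disputed step of a manuscript under audit is used.  Unit `b2b-balaban-pv02` gen 6
(journal CLAIM T4-U5.E 2026-08-18T23:24:59Z); record `t4/T4-EST-U5.md`.
-/

open Finset _root_.Filter _root_.Topology

namespace Literature.MathematicalPhysics.QuantumFieldTheory.Balaban1983to89.T4MatchingAssembly

open T4HybridMatching T4CauchySum T4WeightBudget T4WeightBudgetKP T4PeierlsDomination T4IndicatorShell

/-! ## §1 NE7 in hybrid form as one `Prop`, and its consequence -/

/-- **NE7 IN HYBRID FORM** (the cell's new estimate NE7 — matching of the two runs' final densities modulo constants —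
in the sufficient HYBRID shape of T4-DAG §2 U5: term-wise ratios on good classes, weight on bad classes and shells).
Data, per number of steps `K` and source strength `t`: ONE finite index family `T K` (run A's classes = admissible
large-field histories; run B's terms partially summed into them, node U5d / §3), term weights `A K t`, `B K t`, ONE bad
class `Bad K t` for both runs (interface I-3), shell parts `shA`, `shB` (NE7c), weights `W`, `Wsh`, remainders `δ`, and
the volume factor `vol = |T₁|`.  Clauses: `weight` = NE7b for both runs (`T4WeightBudget.RelWeightBound`, rows
T4-U5c.E / T4-U5.E-a); `shell` = NE7c (`T4IndicatorShell.ShellWeightBound`, row T4-U5b.E2); `lt_one` = bad classes and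
shells are not everything; `summable` = `Σ_K δ_K < ∞` (node U4′); `core` = NE7's TERM-WISE HALF: for each `K` ONE
constant `c` INDEPENDENT of `t` AND of the class `τ` (load-bearing: the producers must deliver one `c_K` per `K`, any
class- or `t`-dependence being booked into the width `vol·δ K`) such that on every good class the cores are sandwiched,
`e^{c − vol·δ_K}(A − shA) ≤ B − shB ≤ e^{c + vol·δ_K}(A − shA)` (nodes U5b/U4′, rows T4-U5.E-b, T4-U5.E-c, T4-U3.B).
HYPOTHESIS SHAPE ONLY — NOT PRINTED for Bałaban's d = 4 procedure; its printed d = 2, 3 template is King's (3.10)–(3.13)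
(small field term-wise, large field by weight), which is cited as TEMPLATE, not as stating this.
[cite: King1986, (3.10)–(3.13) pp. 656–657 (template only)] -/
structure HybridNE7 {ι : Type*} [DecidableEq ι] (l₀ vol : ℝ) (T : ℕ → Finset ι) (A B : ℕ → ℝ → ι → ℝ) (Bad : ℕ → ℝ → Finset ι)
    (W : ℕ → ℝ) (shA shB : ℕ → ℝ → ι → ℝ) (Wsh δ : ℕ → ℝ) : Prop where
  /-- NE7b, both runs: the bad classes have relative weight `≤ W K`, `0 ≤ W K < 1`, `Σ W K < ∞` -/
  weight : RelWeightBound l₀ T A B Bad W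
  /-- NE7c: the indicator shells have relative weight `≤ Wsh K`, `Σ Wsh K < ∞`, `0 ≤ sh ≤ term` -/
  shell : ShellWeightBound l₀ T A B shA shB Wsh
  /-- bad classes plus shells never exhaust the weight -/
  lt_one : ∀ K, W K + Wsh K < 1
  /-- node U4′: the term-wise remainders are summable over the number of steps -/
  summable : Summable δ
  /-- NE7's term-wise half on the good classes, cores only, with a `t`-independent constant -/
  core : ∀ K : ℕ, ∃ c : ℝ, ∀ t : ℝ, |t| ≤ l₀ → ∀ τ ∈ T K \ Bad K t,
    Real.exp (c - vol * δ K) * (A K t τ - shA K t τ) ≤ B K t τ - shB K t τ ∧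
      B K t τ - shB K t τ ≤ Real.exp (c + vol * δ K) * (A K t τ - shA K t τ)

section Main

variable {ι : Type*} [DecidableEq ι] {l₀ vol : ℝ} {T : ℕ → Finset ι} {A B shA shB : ℕ → ℝ → ι → ℝ}
  {Bad : ℕ → ℝ → Finset ι} {W Wsh δ S : ℕ → ℝ}

/-- **NE7 (hybrid form) ⇒ NE7 and node U6's conclusion.**  With the dictionary `Z K t = Σ A K t`, `Z (K+1) t = Σ B K t`
on `|t| ≤ l₀` (nodes E1/E2) and positivity of the total (L1-pos): matching modulo `t`-independent constants with the
remainder `hybridDelta vol δ (W + Wsh)`, its summability, the Cauchy property of every generating function on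
`|t| ≤ l₀`, and uniform convergence there — the tree's `T4IndicatorShell.cauchy_of_relWeightBound_shell`. [folklore] -/
theorem HybridNE7.cauchy {Z : ℕ → ℝ → ℝ} (h : HybridNE7 l₀ vol T A B Bad W shA shB Wsh δ)
    (hvol : 0 < vol) (hl₀ : 0 ≤ l₀)
    (hZA : ∀ K t, |t| ≤ l₀ → Z K t = ∑ τ ∈ T K, A K t τ)
    (hZB : ∀ K t, |t| ≤ l₀ → Z (K + 1) t = ∑ τ ∈ T K, B K t τ)
    (hpos : ∀ K t, |t| ≤ l₀ → 0 < ∑ τ ∈ T K, A K t τ) :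
    MatchingModConstants vol l₀ (hybridDelta vol δ (fun K => W K + Wsh K)) Z ∧
      Summable (hybridDelta vol δ (fun K => W K + Wsh K)) ∧
      (∀ t : ℝ, |t| ≤ l₀ → CauchySeq fun K => genFun Z K t) ∧
      TendstoUniformlyOn (fun K t => genFun Z K t) (genFunLim Z) atTop {t | |t| ≤ l₀} :=
  cauchy_of_relWeightBound_shell hvol hl₀ h.weight h.shell h.lt_one hZA hZB hpos h.summable h.core

/-- NE7 (hybrid form) ⇒ NE7 (`T4CauchySum.MatchingModConstants`, node U5's output shape) with a summable remainder.
[folklore] -/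
theorem HybridNE7.matchingModConstants {Z : ℕ → ℝ → ℝ}
    (h : HybridNE7 l₀ vol T A B Bad W shA shB Wsh δ) (hvol : 0 < vol) (hl₀ : 0 ≤ l₀)
    (hZA : ∀ K t, |t| ≤ l₀ → Z K t = ∑ τ ∈ T K, A K t τ)
    (hZB : ∀ K t, |t| ≤ l₀ → Z (K + 1) t = ∑ τ ∈ T K, B K t τ)
    (hpos : ∀ K t, |t| ≤ l₀ → 0 < ∑ τ ∈ T K, A K t τ) :
    MatchingModConstants vol l₀ (hybridDelta vol δ (fun K => W K + Wsh K)) Z ∧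
      Summable (hybridDelta vol δ (fun K => W K + Wsh K)) :=
  let h' := h.cauchy hvol hl₀ hZA hZB hpos
  ⟨h'.1, h'.2.1⟩

/-- Constructor from NE7b ALREADY in its output shape (any producer of `RelWeightBound`: `relWeightBound_of_slotDom`,
`_of_slotDom_twoRate` (interface I-1), `_of_peierlsDom`, `_of_posDom`, `_of_polymerDom`, `_of_eventually`). [folklore] -/
theorem hybridNE7_of_relWeightBound (hW : RelWeightBound l₀ T A B Bad W) (hSh : ShellWeightBound l₀ T A B shA shB Wsh)
    (hlt : ∀ K, W K + Wsh K < 1) (hδ : Summable δ)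
    (hcore : ∀ K : ℕ, ∃ c : ℝ, ∀ t : ℝ, |t| ≤ l₀ → ∀ τ ∈ T K \ Bad K t,
      Real.exp (c - vol * δ K) * (A K t τ - shA K t τ) ≤ B K t τ - shB K t τ ∧
        B K t τ - shB K t τ ≤ Real.exp (c + vol * δ K) * (A K t τ - shA K t τ)) :
    HybridNE7 l₀ vol T A B Bad W shA shB Wsh δ :=
  ⟨hW, hSh, hlt, hδ, hcore⟩

/-! ## §2 The weight slot in budget form; constructors from the named inputs of row T4-U5.E-a -/

/-- `Wsh K < e^{−S K}` is the budget form of `(1 − e^{−S K}) + Wsh K < 1`. [folklore] -/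
theorem lt_one_of_lt_exp (h : ∀ K, Wsh K < Real.exp (-S K)) (K : ℕ) : (1 - Real.exp (-S K)) + Wsh K < 1 := by
  have := h K
  linarith

/-- **Constructor from row T4-U5.E-a in PEIERLS FORM** (`T4PeierlsDomination.PeierlsDom` for both runs, common slot budget
`S ≥ 0` with `Σ_K S K < ∞`, non-negative terms = interface I-2) + NE7c + the shell smallness in budget form + node U4′ +
the core clause of row T4-U5.E-b.  Weight `W K = 1 − e^{−S K}`. [folklore] -/
theorem hybridNE7_of_peierlsDom (hS0 : ∀ K, 0 ≤ S K) (hS : Summable S)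
    (hA : ∀ K t, |t| ≤ l₀ → ∀ τ ∈ T K, 0 ≤ A K t τ) (hB : ∀ K t, |t| ≤ l₀ → ∀ τ ∈ T K, 0 ≤ B K t τ)
    (hDA : PeierlsDom l₀ T A Bad S) (hDB : PeierlsDom l₀ T B Bad S)
    (hSh : ShellWeightBound l₀ T A B shA shB Wsh) (hlt : ∀ K, Wsh K < Real.exp (-S K)) (hδ : Summable δ)
    (hcore : ∀ K : ℕ, ∃ c : ℝ, ∀ t : ℝ, |t| ≤ l₀ → ∀ τ ∈ T K \ Bad K t,
      Real.exp (c - vol * δ K) * (A K t τ - shA K t τ) ≤ B K t τ - shB K t τ ∧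
        B K t τ - shB K t τ ≤ Real.exp (c + vol * δ K) * (A K t τ - shA K t τ)) :
    HybridNE7 l₀ vol T A B Bad (fun K => 1 - Real.exp (-S K)) shA shB Wsh δ :=
  hybridNE7_of_relWeightBound (relWeightBound_of_peierlsDom hS0 hS hA hB hDA hDB) hSh (lt_one_of_lt_exp hlt) hδ hcore

/-- **Constructor from row T4-U5.E-a in SWITCH-OFF FORM** (`T4HistoryPeeling.SlotDom` for both runs — unit pv14 gen 5's
consumer interface: SAME `T` and `Bad` for both runs, each run its own slots; common budget `S`). [folklore] -/
theorem hybridNE7_of_slotDom (hS0 : ∀ K, 0 ≤ S K) (hS : Summable S)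
    (hA : ∀ K t, |t| ≤ l₀ → ∀ τ ∈ T K, 0 ≤ A K t τ) (hB : ∀ K t, |t| ≤ l₀ → ∀ τ ∈ T K, 0 ≤ B K t τ)
    (hDA : T4HistoryPeeling.SlotDom l₀ T A Bad S) (hDB : T4HistoryPeeling.SlotDom l₀ T B Bad S)
    (hSh : ShellWeightBound l₀ T A B shA shB Wsh) (hlt : ∀ K, Wsh K < Real.exp (-S K)) (hδ : Summable δ)
    (hcore : ∀ K : ℕ, ∃ c : ℝ, ∀ t : ℝ, |t| ≤ l₀ → ∀ τ ∈ T K \ Bad K t,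
      Real.exp (c - vol * δ K) * (A K t τ - shA K t τ) ≤ B K t τ - shB K t τ ∧
        B K t τ - shB K t τ ≤ Real.exp (c + vol * δ K) * (A K t τ - shA K t τ)) :
    HybridNE7 l₀ vol T A B Bad (fun K => 1 - Real.exp (-S K)) shA shB Wsh δ :=
  hybridNE7_of_relWeightBound (T4HistoryPeeling.relWeightBound_of_slotDom hS0 hS hA hB hDA hDB) hSh
    (lt_one_of_lt_exp hlt) hδ hcore

/-- **Constructor from row T4-U5.E-a in KP-FREE GAS FORM** (`T4PeierlsDomination.PosDom` for both runs). [folklore] -/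
theorem hybridNE7_of_posDom (hS0 : ∀ K, 0 ≤ S K) (hS : Summable S)
    (hDA : PosDom l₀ T A Bad S) (hDB : PosDom l₀ T B Bad S)
    (hSh : ShellWeightBound l₀ T A B shA shB Wsh) (hlt : ∀ K, Wsh K < Real.exp (-S K)) (hδ : Summable δ)
    (hcore : ∀ K : ℕ, ∃ c : ℝ, ∀ t : ℝ, |t| ≤ l₀ → ∀ τ ∈ T K \ Bad K t,
      Real.exp (c - vol * δ K) * (A K t τ - shA K t τ) ≤ B K t τ - shB K t τ ∧
        B K t τ - shB K t τ ≤ Real.exp (c + vol * δ K) * (A K t τ - shA K t τ)) :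
    HybridNE7 l₀ vol T A B Bad (fun K => 1 - Real.exp (-S K)) shA shB Wsh δ :=
  hybridNE7_of_relWeightBound (relWeightBound_of_posDom hS0 hS hDA hDB) hSh (lt_one_of_lt_exp hlt) hδ hcore

/-- **Constructor from row T4-U5.E-a in POLYMER-GAS FORM** (`T4WeightBudgetKP.PolymerDom` for both runs — the row's
original instantiation target R3b). [folklore] -/
theorem hybridNE7_of_polymerDom (hS0 : ∀ K, 0 ≤ S K) (hS : Summable S)
    (hDA : PolymerDom l₀ T A Bad S) (hDB : PolymerDom l₀ T B Bad S)
    (hSh : ShellWeightBound l₀ T A B shA shB Wsh) (hlt : ∀ K, Wsh K < Real.exp (-S K)) (hδ : Summable δ)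
    (hcore : ∀ K : ℕ, ∃ c : ℝ, ∀ t : ℝ, |t| ≤ l₀ → ∀ τ ∈ T K \ Bad K t,
      Real.exp (c - vol * δ K) * (A K t τ - shA K t τ) ≤ B K t τ - shB K t τ ∧
        B K t τ - shB K t τ ≤ Real.exp (c + vol * δ K) * (A K t τ - shA K t τ)) :
    HybridNE7 l₀ vol T A B Bad (fun K => 1 - Real.exp (-S K)) shA shB Wsh δ :=
  hybridNE7_of_relWeightBound (relWeightBound_of_polymerDom hS0 hS hDA hDB) hSh (lt_one_of_lt_exp hlt) hδ hcore

omit [DecidableEq ι] in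
/-- THE SHELL-FREE INSTANCE of NE7c: zero shell parts, zero shell weight (the fallback design (ii′) "common classifier"
of row T4-U5b.E2, or any presentation in which the indicators agree on good classes); needs only non-negative terms.
[folklore] -/
theorem shellWeightBound_zero (hA : ∀ K t, |t| ≤ l₀ → ∀ τ ∈ T K, 0 ≤ A K t τ)
    (hB : ∀ K t, |t| ≤ l₀ → ∀ τ ∈ T K, 0 ≤ B K t τ) :
    ShellWeightBound l₀ T A B (fun _ _ _ => 0) (fun _ _ _ => 0) (fun _ => 0) where
  nonneg _ := le_rfl
  summable := summable_zero
  sh_nonneg_left _ _ _ _ _ := le_rfl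
  sh_le_left K t ht τ hτ := hA K t ht τ hτ
  sh_nonneg_right _ _ _ _ _ := le_rfl
  sh_le_right K t ht τ hτ := hB K t ht τ hτ
  left K t ht := by simp
  right K t ht := by simp

/-- **Shell-free constructor**: NE7b in output shape + the PLAIN good-class clause `hgood` of
`T4WeightBudget.hybridSandwich_of_relWeightBound` (no shells) ⇒ `HybridNE7` with zero shells; its `cauchy` is then
`T4WeightBudget.cauchy_of_relWeightBound` up to `W K + 0 = W K`. [folklore] -/
theorem hybridNE7_noShell (hW : RelWeightBound l₀ T A B Bad W)
    (hA : ∀ K t, |t| ≤ l₀ → ∀ τ ∈ T K, 0 ≤ A K t τ) (hB : ∀ K t, |t| ≤ l₀ → ∀ τ ∈ T K, 0 ≤ B K t τ)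
    (hδ : Summable δ)
    (hgood : ∀ K : ℕ, ∃ c : ℝ, ∀ t : ℝ, |t| ≤ l₀ → ∀ τ ∈ T K \ Bad K t,
      Real.exp (c - vol * δ K) * A K t τ ≤ B K t τ ∧ B K t τ ≤ Real.exp (c + vol * δ K) * A K t τ) :
    HybridNE7 l₀ vol T A B Bad W (fun _ _ _ => 0) (fun _ _ _ => 0) (fun _ => 0) δ :=
  hybridNE7_of_relWeightBound hW (shellWeightBound_zero hA hB) (fun K => by simpa using hW.lt_one K) hδ
    (fun K => by
      obtain ⟨c, hc⟩ := hgood K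
      exact ⟨c, fun t ht τ hτ => by simpa using hc t ht τ hτ⟩)

end Main

/-! ## §3 Node U5d at the level of index sets: run B's own terms partially summed into run A's classes -/

section Fibres

variable {ι σ : Type*} [DecidableEq ι] {l₀ : ℝ} {T : ℕ → Finset ι} {A : ℕ → ℝ → ι → ℝ} {Bad : ℕ → ℝ → Finset ι}
  {SB : ℕ → Finset σ} {SBad : ℕ → ℝ → Finset σ} {π : ℕ → σ → ι} {b : ℕ → ℝ → σ → ℝ} {W Wsh : ℕ → ℝ}

/-- Run B's CLASS VALUES on run A's index family: the partial sums of B's own term weights `b K t` over the fibres of the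
class map `π K : σ → ι` (forgetting B's extra finest-scale data) — `T4HybridMatching.fiberSum` per `(K, t)`. [folklore] -/
def classVal (SB : ℕ → Finset σ) (π : ℕ → σ → ι) (b : ℕ → ℝ → σ → ℝ) (K : ℕ) (t : ℝ) (τ : ι) : ℝ :=
  fiberSum (SB K) (π K) (b K t) τ

/-- Partial summation loses nothing: `Σ_{τ ∈ T K} classVal SB π b K t τ = Σ_{s ∈ SB K} b K t s` when `π K` maps `SB K`
into `T K` — so the dictionary clause `Z (K+1) t = Σ_{s ∈ SB K} b K t s` of run B becomes the `hZB` of §1. [folklore] -/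
theorem sum_classVal {K : ℕ} (hmaps : ∀ s ∈ SB K, π K s ∈ T K) (t : ℝ) :
    ∑ τ ∈ T K, classVal SB π b K t τ = ∑ s ∈ SB K, b K t s :=
  sum_fiberSum (b K t) hmaps

/-- Class values of non-negative terms are non-negative (interface I-2 transported). [folklore] -/
theorem classVal_nonneg {K : ℕ} {t : ℝ} (hb : ∀ s ∈ SB K, 0 ≤ b K t s) (τ : ι) : 0 ≤ classVal SB π b K t τ :=
  fiberSum_nonneg hb τ

/-- The class values over a set `G` of classes are the B-terms whose class lies in `G`. [folklore] -/
theorem sum_classVal_eq_filter (K : ℕ) (G : Finset ι) (t : ℝ) :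
    ∑ τ ∈ G, classVal SB π b K t τ = ∑ s ∈ (SB K).filter (fun s => π K s ∈ G), b K t s := by
  unfold classVal fiberSum
  rw [← Finset.sum_fiberwise_of_maps_to (s := (SB K).filter (fun s => π K s ∈ G)) (t := G) (g := π K)
    (fun s hs => (Finset.mem_filter.mp hs).2) (b K t)]
  refine Finset.sum_congr rfl fun τ hτ => Finset.sum_congr ?_ fun _ _ => rfl
  ext s
  simp only [Finset.mem_filter]
  constructor
  · rintro ⟨hs, hπ⟩
    exact ⟨⟨hs, hπ ▸ hτ⟩, hπ⟩
  · rintro ⟨⟨hs, _⟩, hπ⟩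
    exact ⟨hs, hπ⟩

/-- **Run B's bad CLASSES cost at most run B's bad TERMS** (interface I-3 in fibred form): if every B-term over a bad
A-class is itself B-bad (`hcons`) and the B-terms are non-negative, then `Σ_{τ ∈ Bad} classVal ≤ Σ_{s ∈ SBad} b`.
[folklore] -/
theorem classBad_le {K : ℕ} {t : ℝ} (hcons : ∀ s ∈ SB K, π K s ∈ Bad K t → s ∈ SBad K t)
    (hSBad : SBad K t ⊆ SB K) (hb : ∀ s ∈ SB K, 0 ≤ b K t s) :
    ∑ τ ∈ Bad K t, classVal SB π b K t τ ≤ ∑ s ∈ SBad K t, b K t s := by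
  rw [sum_classVal_eq_filter]
  refine Finset.sum_le_sum_of_subset_of_nonneg (fun s hs => ?_) fun s hs _ => hb s (hSBad hs)
  obtain ⟨hs, hπ⟩ := Finset.mem_filter.mp hs
  exact hcons s hs hπ

variable [DecidableEq σ]

/-- Run B's SHELL on A's classes in the fibred presentation: the class sums of B's BAD terms (all of them — those over
bad classes are booked twice, harmlessly; those over GOOD classes are exactly node U5d's finest-scale residue). [folklore] -/
def classShell (SB : ℕ → Finset σ) (SBad : ℕ → ℝ → Finset σ) (π : ℕ → σ → ι) (b : ℕ → ℝ → σ → ℝ) (K : ℕ) (t : ℝ)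
    (τ : ι) : ℝ :=
  fiberSum ((SB K).filter (fun s => s ∈ SBad K t)) (π K) (b K t) τ

/-- The B-shell of a class is non-negative and at most the class value (I-2). [folklore] -/
theorem classShell_nonneg_le {K : ℕ} {t : ℝ} (hb : ∀ s ∈ SB K, 0 ≤ b K t s) (τ : ι) :
    0 ≤ classShell SB SBad π b K t τ ∧ classShell SB SBad π b K t τ ≤ classVal SB π b K t τ := by
  refine ⟨fiberSum_nonneg (fun s hs => hb s (Finset.mem_filter.mp hs).1) τ, ?_⟩
  unfold classShell classVal fiberSum
  refine Finset.sum_le_sum_of_subset_of_nonneg (fun s hs => ?_) fun s hs _ => hb s (Finset.mem_filter.mp hs).1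
  simp only [Finset.mem_filter] at hs ⊢
  exact ⟨hs.1.1, hs.2⟩

/-- The CORE of a class (value minus shell) is the class sum of B's GOOD terms — the object the producers of `hcore`
(rows T4-U5.E-b and T4-U5.E-c) actually sandwich against A's core. [folklore] -/
theorem classVal_sub_classShell (K : ℕ) (t : ℝ) (τ : ι) :
    classVal SB π b K t τ - classShell SB SBad π b K t τ =
      fiberSum ((SB K).filter (fun s => s ∉ SBad K t)) (π K) (b K t) τ := by
  unfold classVal classShell fiberSum
  rw [sub_eq_iff_eq_add, Finset.filter_filter, Finset.filter_filter, ← Finset.sum_filter_add_sum_filter_not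
    ((SB K).filter fun s => π K s = τ) (fun s => s ∉ SBad K t), Finset.filter_filter, Finset.filter_filter]
  congr 1
  · exact Finset.sum_congr (Finset.filter_congr fun s _ => by tauto) fun _ _ => rfl
  · exact Finset.sum_congr (Finset.filter_congr fun s _ => by tauto) fun _ _ => rfl

/-- **The total B-shell costs at most run B's bad terms**: `Σ_{τ ∈ T K} classShell ≤ Σ_{s ∈ SBad} b`; hence a per-run
relative bound `Σ_{SBad} b ≤ w · Σ_{SB} b` (e.g. `T4PeierlsDomination.PeierlsDom.bad_le` for run B on ITS OWN index
family) gives the `right` field of `ShellWeightBound` with `Wsh := w`. [folklore] -/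
theorem shell_right_of_fibres {K : ℕ} {t : ℝ} (hmaps : ∀ s ∈ SB K, π K s ∈ T K) (hSBad : SBad K t ⊆ SB K)
    {w : ℝ} (hbadB : ∑ s ∈ SBad K t, b K t s ≤ w * ∑ s ∈ SB K, b K t s) :
    ∑ τ ∈ T K, classShell SB SBad π b K t τ ≤ w * ∑ τ ∈ T K, classVal SB π b K t τ := by
  have h1 : ∑ τ ∈ T K, classShell SB SBad π b K t τ = ∑ s ∈ (SB K).filter (fun s => s ∈ SBad K t), b K t s :=
    sum_fiberSum (b K t) fun s hs => hmaps s (Finset.mem_filter.mp hs).1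
  have h2 : (SB K).filter (fun s => s ∈ SBad K t) = SBad K t := by
    ext s
    simp only [Finset.mem_filter]
    exact ⟨fun h => h.2, fun h => ⟨hSBad h, h⟩⟩
  rw [h1, h2, sum_classVal hmaps]
  exact hbadB

omit [DecidableEq σ] in
/-- **`RelWeightBound` FROM PER-RUN DATA ON EACH RUN'S OWN INDEX FAMILY** (node U5d ⇒ NE7b's output shape).  Run A:
relative bad-class bound on `ι`.  Run B: its own finite families `SB K`, bad terms `SBad K t ⊆ SB K`, class map `π K`
into `T K`, non-negative terms, a relative bad-TERM bound with the same weights `W`, and the consistency `hcons` of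
interface I-3 (a B-term over a bad A-class is B-bad; the converse may fail at B's finest scale).  Conclusion:
`RelWeightBound l₀ T A (classVal SB π b) Bad W`. [folklore] -/
theorem relWeightBound_of_fibres (hW0 : ∀ K, 0 ≤ W K) (hW1 : ∀ K, W K < 1) (hWs : Summable W)
    (hBad : ∀ K t, |t| ≤ l₀ → Bad K t ⊆ T K)
    (hbadA : ∀ K t, |t| ≤ l₀ → ∑ τ ∈ Bad K t, A K t τ ≤ W K * ∑ τ ∈ T K, A K t τ)
    (hmaps : ∀ K, ∀ s ∈ SB K, π K s ∈ T K) (hSBad : ∀ K t, |t| ≤ l₀ → SBad K t ⊆ SB K)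
    (hcons : ∀ K t, |t| ≤ l₀ → ∀ s ∈ SB K, π K s ∈ Bad K t → s ∈ SBad K t)
    (hb : ∀ K t, |t| ≤ l₀ → ∀ s ∈ SB K, 0 ≤ b K t s)
    (hbadB : ∀ K t, |t| ≤ l₀ → ∑ s ∈ SBad K t, b K t s ≤ W K * ∑ s ∈ SB K, b K t s) :
    RelWeightBound l₀ T A (classVal SB π b) Bad W where
  bad_subset := hBad
  nonneg := hW0
  lt_one := hW1
  summable := hWs
  bad_left := hbadA
  bad_right K t ht := by
    rw [sum_classVal (hmaps K)]
    exact (classBad_le (hcons K t ht) (hSBad K t ht) (hb K t ht)).trans (hbadB K t ht)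

/-- **`ShellWeightBound` IN THE FIBRED PRESENTATION**: run A's shell parts `shA` given on `ι` with their bounds; run B's
shell := `classShell` (its bad terms, class by class) with the relative bad-term bound `≤ Wsh K · Σ b`.  Then the CORE
clause of `HybridNE7` asks, on each good class `τ`, for the sandwich of `A − shA` against the class sum of B's GOOD
terms over `τ` (`classVal_sub_classShell`) — and nothing about B's bad terms anywhere. [folklore] -/
theorem shellWeightBound_of_fibres {shA : ℕ → ℝ → ι → ℝ} (hWsh0 : ∀ K, 0 ≤ Wsh K) (hWshs : Summable Wsh)
    (hshA0 : ∀ K t, |t| ≤ l₀ → ∀ τ ∈ T K, 0 ≤ shA K t τ) (hshA : ∀ K t, |t| ≤ l₀ → ∀ τ ∈ T K, shA K t τ ≤ A K t τ)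
    (hshAW : ∀ K t, |t| ≤ l₀ → ∑ τ ∈ T K, shA K t τ ≤ Wsh K * ∑ τ ∈ T K, A K t τ)
    (hmaps : ∀ K, ∀ s ∈ SB K, π K s ∈ T K) (hSBad : ∀ K t, |t| ≤ l₀ → SBad K t ⊆ SB K)
    (hb : ∀ K t, |t| ≤ l₀ → ∀ s ∈ SB K, 0 ≤ b K t s)
    (hbadB : ∀ K t, |t| ≤ l₀ → ∑ s ∈ SBad K t, b K t s ≤ Wsh K * ∑ s ∈ SB K, b K t s) :
    ShellWeightBound l₀ T A (classVal SB π b) shA (classShell SB SBad π b) Wsh where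
  nonneg := hWsh0
  summable := hWshs
  sh_nonneg_left := hshA0
  sh_le_left := hshA
  sh_nonneg_right K t ht τ _ := (classShell_nonneg_le (hb K t ht) τ).1
  sh_le_right K t ht τ _ := (classShell_nonneg_le (hb K t ht) τ).2
  left := hshAW
  right K t ht := shell_right_of_fibres (hmaps K) (hSBad K t ht) (hbadB K t ht)

/-- **Run B's Peierls domination ON ITS OWN INDEX FAMILY gives both B-side inputs of the fibred presentation** — the
relative bad-term bound with weight `1 − e^{−S K}` (`PeierlsDom.bad_le`), usable as `hbadB` of `relWeightBound_of_fibres`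
AND of `shellWeightBound_of_fibres`. [folklore] -/
theorem badB_of_peierlsDom {S : ℕ → ℝ} (hDB : PeierlsDom l₀ SB b SBad S)
    (hb : ∀ K t, |t| ≤ l₀ → ∀ s ∈ SB K, 0 ≤ b K t s) (K : ℕ) (t : ℝ) (ht : |t| ≤ l₀) :
    ∑ s ∈ SBad K t, b K t s ≤ (1 - Real.exp (-S K)) * ∑ s ∈ SB K, b K t s :=
  hDB.bad_le hb K t ht

end Fibres

/-! ## §4 Summability is a tail property: the free head and the glued remainder sequence -/

section HeadTail

variable {vol l₀ : ℝ} {Z : ℕ → ℝ → ℝ}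

/-- The GLUED REMAINDER SEQUENCE: `h` on the head `K < K₀`, the tail's remainders re-indexed from `K₀` on. [folklore] -/
noncomputable def glueDelta (K₀ : ℕ) (h : ℝ) (δ : ℕ → ℝ) (K : ℕ) : ℝ :=
  if K < K₀ then h else δ (K - K₀)

/-- On the head the glued remainder is the head bound. [folklore] -/
theorem glueDelta_of_lt {K₀ K : ℕ} (hK : K < K₀) (h : ℝ) (δ : ℕ → ℝ) : glueDelta K₀ h δ K = h := by
  simp [glueDelta, hK]

/-- On the tail the glued remainder is the tail's, re-indexed. [folklore] -/
theorem glueDelta_add (K₀ : ℕ) (h : ℝ) (δ : ℕ → ℝ) (K : ℕ) : glueDelta K₀ h δ (K₀ + K) = δ K := by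
  have h1 : ¬ (K₀ + K < K₀) := by omega
  simp [glueDelta, h1]

/-- The glued sequence is summable if the tail is: a finite head never matters. [folklore] -/
theorem summable_glueDelta (K₀ : ℕ) (h : ℝ) {δ : ℕ → ℝ} (hδ : Summable δ) : Summable (glueDelta K₀ h δ) := by
  rw [← summable_nat_add_iff K₀]
  have e : (fun K => glueDelta K₀ h δ (K + K₀)) = δ := by
    funext K
    rw [Nat.add_comm]
    exact glueDelta_add K₀ h δ K
  rw [e]
  exact hδ

/-- Glued remainders are non-negative if the head bound and the tail remainders are. [folklore] -/
theorem glueDelta_nonneg {K₀ : ℕ} {h : ℝ} {δ : ℕ → ℝ} (hh : 0 ≤ h) (hδ : ∀ K, 0 ≤ δ K) (K : ℕ) :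
    0 ≤ glueDelta K₀ h δ K := by
  unfold glueDelta
  split_ifs
  · exact hh
  · exact hδ _

/-- **GLUING.**  Matching modulo constants of the TAIL `K ↦ Z (K₀ + K)` with remainders `vol · δ K`, and ANY two-sided
bounds `M` with `t`-independent constants on the head `K < K₀`, give matching modulo constants of `Z` itself with the
glued remainder sequence. [folklore] -/
theorem matchingModConstants_glue {K₀ : ℕ} {δ : ℕ → ℝ} {M : ℝ} (hvol : 0 < vol)
    (htail : MatchingModConstants vol l₀ δ fun K => Z (K₀ + K))
    (hhead : ∀ K < K₀, ∃ c : ℝ, ∀ t : ℝ, |t| ≤ l₀ → |Real.log (Z (K + 1) t) - Real.log (Z K t) - c| ≤ M) :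
    MatchingModConstants vol l₀ (glueDelta K₀ (M / vol) δ) Z := by
  intro K
  by_cases hK : K < K₀
  · obtain ⟨c, hc⟩ := hhead K hK
    refine ⟨c, fun t ht => ?_⟩
    have hM : vol * (M / vol) = M := by field_simp
    rw [glueDelta_of_lt hK, hM]
    exact hc t ht
  · obtain ⟨j, rfl⟩ : ∃ j, K = K₀ + j := ⟨K - K₀, by omega⟩
    obtain ⟨c, hc⟩ := htail j
    refine ⟨c, fun t ht => ?_⟩
    rw [glueDelta_add]
    simpa [Nat.add_assoc] using hc t ht

/-- **THE HEAD IS FREE.**  A uniform bound `|genFun Z K t| ≤ G` on `|t| ≤ l₀` (for the scheme: `|G_K(t)| ≤ |t|`, node E2)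
gives, for EVERY `K`, `|log Z_{K+1}(t) − log Z_K(t) − c_K| ≤ 2G` with the `t`-independent constant
`c_K = log Z_{K+1}(0) − log Z_K(0)` — no comparison of the runs at all. [folklore] -/
theorem head_of_abs_genFun_le {G : ℝ} (hG : ∀ K t, |t| ≤ l₀ → |genFun Z K t| ≤ G) (K : ℕ) :
    ∃ c : ℝ, ∀ t : ℝ, |t| ≤ l₀ → |Real.log (Z (K + 1) t) - Real.log (Z K t) - c| ≤ 2 * G := by
  refine ⟨Real.log (Z (K + 1) 0) - Real.log (Z K 0), fun t ht => ?_⟩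
  have h1 := hG (K + 1) t ht
  have h2 := hG K t ht
  have e : Real.log (Z (K + 1) t) - Real.log (Z K t) - (Real.log (Z (K + 1) 0) - Real.log (Z K 0)) =
      genFun Z (K + 1) t - genFun Z K t := by
    unfold genFun
    ring
  rw [e]
  rw [abs_le] at h1 h2 ⊢
  constructor <;> linarith [h1.1, h1.2, h2.1, h2.2]

/-- Tail matching + free head ⇒ matching of the whole sequence with a summable glued remainder. [folklore] -/
theorem matchingModConstants_of_tail {K₀ : ℕ} {δ : ℕ → ℝ} {G : ℝ} (hvol : 0 < vol)
    (htail : MatchingModConstants vol l₀ δ fun K => Z (K₀ + K))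
    (hG : ∀ K t, |t| ≤ l₀ → |genFun Z K t| ≤ G) :
    MatchingModConstants vol l₀ (glueDelta K₀ (2 * G / vol) δ) Z :=
  matchingModConstants_glue hvol htail fun K _ => head_of_abs_genFun_le hG K

variable {ι : Type*} [DecidableEq ι] {T : ℕ → Finset ι} {A B shA shB : ℕ → ℝ → ι → ℝ} {Bad : ℕ → ℝ → Finset ι}
  {W Wsh δ : ℕ → ℝ}

/-- **NE7 (hybrid form) FROM `K₀` ON + the free head ⇒ NE7 for the whole sequence, with a summable remainder.**  The
datum represents the SHIFTED dressed partition functions `K ↦ Z (K₀ + K)`; below `K₀` only `|genFun Z K t| ≤ G` is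
used. [folklore] -/
theorem HybridNE7.matchingModConstants_tail {K₀ : ℕ} {G : ℝ} (h : HybridNE7 l₀ vol T A B Bad W shA shB Wsh δ)
    (hvol : 0 < vol) (hl₀ : 0 ≤ l₀)
    (hZA : ∀ K t, |t| ≤ l₀ → Z (K₀ + K) t = ∑ τ ∈ T K, A K t τ)
    (hZB : ∀ K t, |t| ≤ l₀ → Z (K₀ + K + 1) t = ∑ τ ∈ T K, B K t τ)
    (hpos : ∀ K t, |t| ≤ l₀ → 0 < ∑ τ ∈ T K, A K t τ)
    (hG : ∀ K t, |t| ≤ l₀ → |genFun Z K t| ≤ G) :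
    MatchingModConstants vol l₀ (glueDelta K₀ (2 * G / vol) (hybridDelta vol δ (fun K => W K + Wsh K))) Z ∧
      Summable (glueDelta K₀ (2 * G / vol) (hybridDelta vol δ (fun K => W K + Wsh K))) := by
  obtain ⟨hM, hS⟩ := h.matchingModConstants (Z := fun K => Z (K₀ + K)) hvol hl₀ hZA
    (fun K t ht => by simpa [Nat.add_assoc] using hZB K t ht) hpos
  exact ⟨matchingModConstants_of_tail hvol hM hG, summable_glueDelta K₀ _ hS⟩

/-- … hence every generating function of `Z` is Cauchy on `|t| ≤ l₀`, uniformly (node U6's conclusion for the whole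
sequence). [folklore] -/
theorem HybridNE7.cauchy_tail {K₀ : ℕ} {G : ℝ} (h : HybridNE7 l₀ vol T A B Bad W shA shB Wsh δ)
    (hvol : 0 < vol) (hl₀ : 0 ≤ l₀)
    (hZA : ∀ K t, |t| ≤ l₀ → Z (K₀ + K) t = ∑ τ ∈ T K, A K t τ)
    (hZB : ∀ K t, |t| ≤ l₀ → Z (K₀ + K + 1) t = ∑ τ ∈ T K, B K t τ)
    (hpos : ∀ K t, |t| ≤ l₀ → 0 < ∑ τ ∈ T K, A K t τ)
    (hG : ∀ K t, |t| ≤ l₀ → |genFun Z K t| ≤ G) :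
    (∀ t : ℝ, |t| ≤ l₀ → CauchySeq fun K => genFun Z K t) ∧
      TendstoUniformlyOn (fun K t => genFun Z K t) (genFunLim Z) atTop {t | |t| ≤ l₀} := by
  obtain ⟨hM, hS⟩ := h.matchingModConstants_tail hvol hl₀ hZA hZB hpos hG
  exact ⟨fun t ht => cauchySeq_genFun hM hl₀ hS ht, tendstoUniformlyOn_genFun hM hl₀ hS⟩

end HeadTail

/-! ## §5 The plug into the scheme: per string, then `GenFunCauchy` and the node-U0 targets of `T4Assembly` -/

section Scheme

open Missing T4Continuum T4Assembly

variable {G : Type*} [GaugeGroup G] [MeasurableSpace G] [RegularGaugeGroup G] [HaarData G] {O : Type*}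

/-- A `HybridNE7` DATUM FOR ONE STRING of a scheme from `K₀` on: an index type, the families of §1, and the dictionary
identifying the string's dressed partition functions `schemeZ S os (K₀ + K)`, `schemeZ S os (K₀ + K + 1)` with the two
runs' term sums on `|t| ≤ l₀` (nodes E1/E2 for run A = `K₀ + K` steps and run B = `K₀ + K + 1` steps).  A `Prop`
(existential over the data; the index type is taken in `Type` — enough for the finite history families intended);
HYPOTHESIS SHAPE ONLY. [folklore] -/
def StringHybridNE7 (S : TorusScheme G O) (os : List O) (l₀ vol : ℝ) (K₀ : ℕ) : Prop :=
  ∃ (ι : Type) (_ : DecidableEq ι) (T : ℕ → Finset ι) (A B shA shB : ℕ → ℝ → ι → ℝ) (Bad : ℕ → ℝ → Finset ι)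
    (W Wsh δ : ℕ → ℝ),
    HybridNE7 l₀ vol T A B Bad W shA shB Wsh δ ∧
      (∀ K t, |t| ≤ l₀ → T4GenFunBounds.schemeZ S os (K₀ + K) t = ∑ τ ∈ T K, A K t τ) ∧
      (∀ K t, |t| ≤ l₀ → T4GenFunBounds.schemeZ S os (K₀ + K + 1) t = ∑ τ ∈ T K, B K t τ)

/-- **PER STRING: NE7 (hybrid form) from `K₀` on ⇒ node U5's output for the string's dressed partition functions**, with
positivity DISCHARGED (`T4GenFunBounds.dressedZ_pos`) and the head FREE (`abs_genFun_schemeZ_le`: `|G_K(t)| ≤ |t| ≤ l₀`),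
for a scheme with `β_K ≥ 0` and measurable observables bounded by `1`.  Output literally the per-string hypothesis of
`T4Assembly.genFunCauchy_of_matchingModConstants`. [folklore] -/
theorem matchingModConstants_schemeZ (S : TorusScheme G O) (hβ : ∀ K, 0 ≤ S.β K)
    (hm : ∀ K o, Measurable (S.obs K o)) (h1 : ∀ K o U, |S.obs K o U| ≤ 1) {l₀ vol : ℝ} (hl₀ : 0 ≤ l₀)
    (hvol : 0 < vol) (os : List O) {K₀ : ℕ} (h : StringHybridNE7 S os l₀ vol K₀) :
    ∃ δ' : ℕ → ℝ, Summable δ' ∧ MatchingModConstants vol l₀ δ' (T4GenFunBounds.schemeZ S os) := by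
  obtain ⟨ι, _, T, A, B, shA, shB, Bad, W, Wsh, δ, hH, hZA, hZB⟩ := h
  have hpos : ∀ K t, |t| ≤ l₀ → 0 < ∑ τ ∈ T K, A K t τ := fun K t ht => by
    rw [← hZA K t ht]
    unfold T4GenFunBounds.schemeZ
    exact T4GenFunBounds.dressedZ_pos (S.P (K₀ + K)) (hβ (K₀ + K))
      (T4GenFunBounds.measurable_prodObs S hm (K₀ + K) os) (T4GenFunBounds.abs_prodObs_le_one S h1 (K₀ + K) os) t
  have hG : ∀ K t, |t| ≤ l₀ → |genFun (T4GenFunBounds.schemeZ S os) K t| ≤ l₀ := fun K t ht =>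
    (T4GenFunBounds.abs_genFun_schemeZ_le S hβ hm h1 K os t).trans ht
  obtain ⟨hM, hS⟩ := hH.matchingModConstants_tail hvol hl₀ hZA hZB hpos hG
  exact ⟨_, hS, hM⟩

/-- **ALL STRINGS: NE7 (hybrid form) per string from some `K₀` on ⇒ `T4Assembly.GenFunCauchy S l₀`** (node U6's output
shape) — by `T4Assembly.genFunCauchy_of_matchingModConstants`. [folklore] -/
theorem genFunCauchy_of_hybridNE7 (S : TorusScheme G O) (hβ : ∀ K, 0 ≤ S.β K)
    (hm : ∀ K o, Measurable (S.obs K o)) (h1 : ∀ K o U, |S.obs K o U| ≤ 1) {l₀ : ℝ} (hl₀ : 0 ≤ l₀)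
    (h : ∀ os : List O, ∃ (vol : ℝ) (K₀ : ℕ), 0 < vol ∧ StringHybridNE7 S os l₀ vol K₀) : GenFunCauchy S l₀ :=
  genFunCauchy_of_matchingModConstants S hl₀ fun os => by
    obtain ⟨vol, K₀, hvol, hH⟩ := h os
    obtain ⟨δ', hδ', hM⟩ := matchingModConstants_schemeZ S hβ hm h1 hl₀ hvol os hH
    exact ⟨vol, δ', hδ', hM⟩

/-- **… ⇒ THE NODE-U0 TARGETS**: the continuum limit of every joint expectation EXISTS along the full sequence of spacings,
the limit points are UNIQUE label by label, and any two subsequential limit functionals AGREE — the tree's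
`T4Assembly.hasContinuumLimit_of_genFunCauchy` / `hasUniqueLimitPoints_of_genFunCauchy` / `limitPointsAgree_of_genFunCauchy`
(`0 < l₀`).  CONDITIONAL on the per-string `HybridNE7` data — the cell's located new estimates, none in print. [folklore] -/
theorem hasContinuumLimit_of_hybridNE7 (S : TorusScheme G O) (hβ : ∀ K, 0 ≤ S.β K)
    (hm : ∀ K o, Measurable (S.obs K o)) (h1 : ∀ K o U, |S.obs K o U| ≤ 1) {l₀ : ℝ} (hl₀ : 0 < l₀)
    (h : ∀ os : List O, ∃ (vol : ℝ) (K₀ : ℕ), 0 < vol ∧ StringHybridNE7 S os l₀ vol K₀) :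
    HasContinuumLimit S ∧ HasUniqueLimitPoints S ∧ LimitPointsAgree S :=
  have hU6 : GenFunCauchy S l₀ := genFunCauchy_of_hybridNE7 S hβ hm h1 hl₀.le h
  ⟨hasContinuumLimit_of_genFunCauchy S hβ hm h1 hl₀ hU6, hasUniqueLimitPoints_of_genFunCauchy S hβ hm h1 hl₀ hU6,
    limitPointsAgree_of_genFunCauchy S hβ hm h1 hl₀ hU6⟩

end Scheme

/-! ## §6 Sanity: the hybrid shape is inhabited -/

section Sanity

/-- SANITY (non-vacuity of `HybridNE7`): one class, equal unit weights in both runs, no bad class, no shells, zero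
remainders — the structure holds with `W = Wsh = δ = 0`, and `HybridNE7.cauchy` then returns matching with remainder
`hybridDelta vol 0 0 = 0`.  Shows only that the clauses are jointly satisfiable; the content of NE7 is in its producers.
[folklore] -/
theorem hybridNE7_trivial (l₀ vol : ℝ) :
    HybridNE7 l₀ vol (fun _ => ({()} : Finset Unit)) (fun _ _ _ => 1) (fun _ _ _ => 1) (fun _ _ => ∅) (fun _ => 0)
      (fun _ _ _ => 0) (fun _ _ _ => 0) (fun _ => 0) (fun _ => 0) := by
  refine hybridNE7_noShell ?_ (fun _ _ _ _ _ => zero_le_one) (fun _ _ _ _ _ => zero_le_one) summable_zero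
    (fun K => ⟨0, fun t _ τ _ => by simp⟩)
  exact
    { bad_subset := fun _ _ _ => Finset.empty_subset _
      nonneg := fun _ => le_rfl
      lt_one := fun _ => zero_lt_one
      summable := summable_zero
      bad_left := fun _ _ _ => by simp
      bad_right := fun _ _ _ => by simp }

end Sanity

/-! ## §7 The fully named instantiation: the loci of WHY-IT-MIGHT-FAIL (2) and (4) as binders (v1.1, append-only) -/

section Named

open T4Crossover

variable {ι : Type*} [DecidableEq ι] {l₀ vol : ℝ} {T : ℕ → Finset ι} {A B shA shB : ℕ → ℝ → ι → ℝ}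
  {Bad : ℕ → ℝ → Finset ι} {Wsh : ℕ → ℝ}

/-- **NE7 (hybrid form) FROM THE NAMED TREE PRODUCERS, every analytic input a visible binder.**  Weight half (row
T4-U5.E-a in switch-off form with the TWO-RATE slot budget `S K = C_s·V·r^{K − j⋆(K) + 1}/(1 − r)`): `hCs hV h0 h1 hc` and
INTERFACE CONDITION I-1 `hfrac : c·K ≤ K − j⋆(K)` — the locus of WHY-IT-MIGHT-FAIL (2) (the survival window versus `p₀(g)`:
whatever the window, only `0 < r < 1` and a positive fraction of old scales are consumed); non-negative terms `hA hB`
(I-2); `SlotDom` for both runs with the SAME `T`, `Bad` (I-3).  Shell half (row T4-U5b.E2): `hSh` and the budget-form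
smallness `hlt : Wsh K < exp(−S K)`.  Remainders (node U4′): `δ = crossoverDelta E a θ Λ R₁ C κ₀ gs w`, summable by
`T4Crossover.summable_crossoverDelta` from `0 < a < 1` (node U4 contraction), `0 < θ < 1`, `θ ≤ Λ` (node U2's scale-shift
RATE — the locus of WHY-IT-MIGHT-FAIL (4): without `hθ1 : θ < 1` there is no theorem), the lower (0.31) recursion `h031` with
non-negative couplings, `R₁, C ≥ 0`, `4 < κ₀` (crossover slack) and a summable extra `w` (e.g. the U5b tail of I-1 or the
finest-scale B-shell bookkeeping); and the core clause of rows T4-U5.E-b / T4-U5.E-c with THESE remainders.  Conclusion: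
`HybridNE7` with weight `1 − exp(−S K)` and remainder `δ`; then `HybridNE7.cauchy` / `matchingModConstants_tail` /
`matchingModConstants_schemeZ` apply verbatim. [folklore] -/
theorem hybridNE7_of_slotDom_twoRate_crossover {E a θ Λ b β' R₁ C : ℝ} {κ₀ : ℕ} {g : ℕ → ℝ} {gs : ℕ → ℕ → ℝ}
    {w : ℕ → ℝ} {Cs V r c : ℝ} {jstar : ℕ → ℕ}
    (ha0 : 0 < a) (ha1 : a < 1) (hθ : 0 < θ) (hθ1 : θ < 1) (hθΛ : θ ≤ Λ) (hb : 0 < b)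
    (h031 : ∀ K, Step.Discrete031 b β' K (g K) (gs K)) (hgs : ∀ K k, k ≤ K → 0 ≤ gs K k) (hR₁ : 0 ≤ R₁)
    (hC : 0 ≤ C) (hκ : 4 < κ₀) (hw : Summable w)
    (hCs : 0 ≤ Cs) (hV : 0 ≤ V) (h0 : 0 < r) (h1 : r < 1) (hc : 0 < c)
    (hfrac : ∀ K : ℕ, c * K ≤ ((K - jstar K : ℕ) : ℝ))
    (hA : ∀ K t, |t| ≤ l₀ → ∀ τ ∈ T K, 0 ≤ A K t τ) (hB : ∀ K t, |t| ≤ l₀ → ∀ τ ∈ T K, 0 ≤ B K t τ)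
    (hDA : T4HistoryPeeling.SlotDom l₀ T A Bad fun K => Cs * V * (r ^ (K - jstar K + 1) / (1 - r)))
    (hDB : T4HistoryPeeling.SlotDom l₀ T B Bad fun K => Cs * V * (r ^ (K - jstar K + 1) / (1 - r)))
    (hSh : ShellWeightBound l₀ T A B shA shB Wsh)
    (hlt : ∀ K, Wsh K < Real.exp (-(Cs * V * (r ^ (K - jstar K + 1) / (1 - r)))))
    (hcore : ∀ K : ℕ, ∃ c₀ : ℝ, ∀ t : ℝ, |t| ≤ l₀ → ∀ τ ∈ T K \ Bad K t,
      Real.exp (c₀ - vol * crossoverDelta E a θ Λ R₁ C κ₀ gs w K) * (A K t τ - shA K t τ) ≤ B K t τ - shB K t τ ∧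
        B K t τ - shB K t τ ≤ Real.exp (c₀ + vol * crossoverDelta E a θ Λ R₁ C κ₀ gs w K) * (A K t τ - shA K t τ)) :
    HybridNE7 l₀ vol T A B Bad (fun K => 1 - Real.exp (-(Cs * V * (r ^ (K - jstar K + 1) / (1 - r))))) shA shB Wsh
      (crossoverDelta E a θ Λ R₁ C κ₀ gs w) :=
  hybridNE7_of_relWeightBound (T4HistoryPeeling.relWeightBound_of_slotDom_twoRate hCs hV h0 h1 hc hfrac hA hB hDA hDB)
    hSh (lt_one_of_lt_exp hlt) (summable_crossoverDelta ha0 ha1 hθ hθ1 hθΛ hb h031 hgs hR₁ hC hκ hw) hcore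

end Named

end Literature.MathematicalPhysics.QuantumFieldTheory.Balaban1983to89.T4MatchingAssembly
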